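import Summits.BirchSwinnertonDyer.BirchSwinnertonDyer.Theorems.KatoDescentPotSupersingularKatoFiniteLevelStrictCompactKernel
import Summits.BirchSwinnertonDyer.Rank1Residual.GaloisImage.SelmerGroupFinite
import Summits.BirchSwinnertonDyer.Rank1Residual.X11b.LevelLiftingLower
import HarnessLib

/-!
# Kato's (14.9.3) at finite level, part 19: the SELF-CONTAINED statement in `Kato2004` vocabulary —
# `#( H¹(ℤ[1/p],T_pE) / (H¹(ℤ[1/p],T_pE) ∩ p^k H¹(ℚ,T_pE)) ) ≤ #Ш(E/ℚ)[p^∞] · ∏_{ℓ∈T∖{p}} #E(ℚ_ℓ)[p^∞] · #E(ℚ_p)[p^k] · p^k`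
# for all large `k` (route `KatoDescentPotSupersingular` / `…Tame…`, crux M = stmt-BirchSwinnertonDyer-19196; route-free helper)

Seat `bsd-potss-rkm` g17 (prover; cell `bsd-potss`), item stmt-BirchSwinnertonDyer-19196 (`--supports … --as helper`; closes
nothing).  HONEST FRAMING: BSD is not proved by any of this; nothing is booked; theorems only (no definition, no named fact).

Parts 1–18 quantified over Kato's Selmer structures as parameters.  Such structures exist trivially
(`SelmerStructure.ofFinite`), and for the finite module `E[p^k]` the relaxed group `H¹_ℛ(ℚ, E[p^k])` is finite
(tree `SelmerFinite.finite_selmerGroup_of_unramified_outside`, Milne *ADT* I §4 / AEC X.4.3), so everything assembles into ONE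
statement about the tree's PINNED objects `A = Kato2004.integralH1 (tateRep W p) p ⊤` (`= H¹(ℤ[1/p], T_pE)`, Kato §8.2) and
`H¹(⊤, T_pE)`:

**`natCard_integralH1_quot_le_sha_points`** — `E/ℚ` elliptic, `p` odd, `E(ℚ)` finite (rank `0`), `Ш(E/ℚ)[p^∞]` finite, a finite set
`T ∋ v_p` of primes with good reduction outside, the `I_ℓ`-fixed points of `E[p^∞]` finite at each `ℓ ∈ T ∖ {v_p}`, and
`SelmerComplement` for THE invariant maps `LocalInvariants.canonical ℚ (p^k)` (all `k`; Poitou–Tate): `∃ k₀ ∀ k ≥ k₀`,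
  `#(A ⧸ {a ∈ A | a ∈ p^k · H¹(⊤, T_pE)}) ≤ #Ш(E/ℚ)[p^∞] · ∏_{ℓ ∈ T∖{v_p}} #E(ℚ_ℓ)[p^∞] · (#E(ℚ_p)[p^k] · p^k)`.
This is Kato's chain (proof of Prop. 14.16, pp. 244–245) `H¹(ℤ[1/p],T)/(p^k…) ↪ H¹(ℤ[1/p],T/p^k)` + (14.9.3) + §14.8, kernel-verified,
with every factor a classical finite group.  What it does NOT contain: the lower bound `#(A/…) ≥ p^k · …` from `rank A = 1`
(Kato Thm. 14.5, the Euler-system input `z`), Kato 14.18 (`L(E,1)/Ω`), `V_pE^{I_ℓ} = 0`, Néron.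

References: K. Kato, Astérisque 295 (2004) §8.2, §13.8, §14.8, (14.9.3), Prop. 14.16 [Kato2004Asterisque]; J. S. Milne, *ADT* I §4
[MilneADT2006]; J. H. Silverman, *AEC* X.4.3 [SilvermanAEC2009].
-/

-- the summit and its single problem are both named `BirchSwinnertonDyer` (registry layout D-0017)
set_option linter.dupNamespace false
set_option autoImplicit false

noncomputable section

open scoped Classical ContRepresentation NumberField
open Function Field NumberField IsDedekindDomain
open Literature.NumberTheory.EllipticCurves Literature.NumberTheory.GaloisRepresentations
  Literature.NumberTheory.GaloisRepresentations.DiscreteGaloisModule Literature.NumberTheory.GaloisCohomology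
open Literature.NumberTheory.EllipticCurves.Kato2004 Literature.NumberTheory.EllipticCurves.Kato2004.EulerSystemValues
open Summit.BirchSwinnertonDyer.Rank1Residual.X11b.LocBridge
open WeierstrassCurve (geomTorsion geomPoints)

namespace Summit.BirchSwinnertonDyer.BirchSwinnertonDyer.Theorems.KatoFiniteLevelCount

section Kato1416

variable (W : WeierstrassCurve ℚ) [W.IsElliptic] (p : ℕ) [Fact p.Prime] [ContinuousSMul ℤ_[p] (W.tateModule p)]

omit [ContinuousSMul ℤ_[p] (W.tateModule p)] in
/-- `E[p^k]` (`Kato2004` level dialect) is unramified at a prime `v ≠ v_p` of good reduction (Silverman VII.4.1, X11b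
`isUnramifiedAt_torsionGaloisModule`). [cite: SilvermanAEC2009, Prop. VII.4.1] -/
theorem isUnramifiedAt_torsionGaloisModule_intPow (k : ℕ) {v : HeightOneSpectrum (𝓞 ℚ)} (hv : v ≠ primePlace p)
    (hgood : W.HasGoodReductionAt v) : GaloisRep.IsUnramifiedAt v (W.torsionGaloisModule ((p : ℤ) ^ k)) := by
  refine Rank1Residual.X11b.AcSelmer.isUnramifiedAt_torsionGaloisModule W hgood ?_
  rw [Int.cast_pow, Int.cast_natCast]
  exact fun h => natCast_not_mem_of_ne_primePlace p hv (v.isPrime.mem_of_pow_mem k h)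

omit [ContinuousSMul ℤ_[p] (W.tateModule p)] in
/-- **`H¹_ℛ(ℚ, E[p^k])` is finite** for Kato's relaxed structure (finite module, unramified conditions outside the finite `T`).
[cite: MilneADT2006, Ch. I §4] [cite: SilvermanAEC2009, X.4.3] -/
theorem finite_selmerGroup_relaxed_intPow (k : ℕ) (T : Finset (HeightOneSpectrum (𝓞 ℚ))) (hpT : primePlace p ∈ T)
    (hT : ∀ v : HeightOneSpectrum (𝓞 ℚ), v ∉ T → W.HasGoodReductionAt v)
    (ℛ : SelmerStructure (W.torsionGaloisModule ((p : ℤ) ^ k)))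
    (hℛur : ∀ v : HeightOneSpectrum (𝓞 ℚ), v ≠ primePlace p →
      ℛ (Sum.inr v) = unramifiedSubgroup (GaloisRep.toLocal v (W.torsionGaloisModule ((p : ℤ) ^ k))) 1) :
    Finite ℛ.selmerGroup := by
  haveI : NeZero ((p : ℤ) ^ k) := ⟨pow_ne_zero k (by exact_mod_cast (Fact.out : p.Prime).ne_zero)⟩
  haveI : NeZero (p ^ k) := ⟨pow_ne_zero k (Fact.out : p.Prime).ne_zero⟩
  haveI : Finite (geomTorsion W ((p : ℤ) ^ k)) := by
    have h := finite_geomTorsion_of_neZero W (p ^ k)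
    rwa [Nat.cast_pow] at h
  exact Rank1Residual.GaloisImage.SelmerFinite.finite_selmerGroup_of_unramified_outside
    (W.torsionGaloisModule ((p : ℤ) ^ k)) (S := (T : Set (HeightOneSpectrum (𝓞 ℚ)))) T.finite_toSet
    (fun v hv => isUnramifiedAt_torsionGaloisModule_intPow W p k (fun h => hv (h ▸ hpT)) (hT v hv))
    (fun v hv => hℛur v (fun h => hv (h ▸ hpT)))

/-- **Kato's Prop. 14.16 (2), kernel half, self-contained, in `Kato2004` vocabulary.**  See the module docstring.
[cite: Kato2004Asterisque, §8.2 (p. 180), §13.8 (p. 228), §14.8 (p. 238), (14.9.3) (p. 240), Prop. 14.16 (pp. 244–245)] -/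
theorem natCard_integralH1_quot_le_sha_points (hodd : p ≠ 2) (T : Finset (HeightOneSpectrum (𝓞 ℚ)))
    (hpT : primePlace p ∈ T) (hT : ∀ v : HeightOneSpectrum (𝓞 ℚ), v ∉ T → W.HasGoodReductionAt v)
    (hI : ∀ v ∈ T \ {primePlace p}, Set.Finite {x : W.geomPrimaryTorsion p |
      ∀ τ ∈ absInertia (v.adicCompletion ℚ), GaloisRep.toLocal v (primaryGaloisModule W p) τ x = x})
    [Finite W.toAffine.Point] [Finite (AddCommGroup.primaryComponent W.sha p)]
    (hSC : ∀ k : ℕ, (LocalInvariants.canonical ℚ (p ^ k)).SelmerComplement) :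
    ∃ k₀ : ℕ, ∀ k, k₀ ≤ k →
      Nat.card (integralH1 (tateRep W p) p ⊤ ⧸
          AddSubgroup.comap (integralH1 (tateRep W p) p ⊤).toAddSubgroup.subtype
            (LinearMap.range (DistribSMul.toLinearMap ℤ_[p] (H1 (tateRep W p) ⊤)
              ((p : ℤ_[p]) ^ k))).toAddSubgroup) ≤
        Nat.card (AddCommGroup.primaryComponent W.sha p) *
          (∏ v ∈ T \ {primePlace p},
            Nat.card (AddCommGroup.primaryComponent (W.baseChange (v.adicCompletion ℚ)).toAffine.Point p)) *
          (Nat.card (nsmulAddMonoidHom (p ^ k) :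
            (W.baseChange ((primePlace p).adicCompletion ℚ)).toAffine.Point →+ _).ker * p ^ k) := by
  -- Kato's structures on `E[p^∞]`
  let 𝓢inf : SelmerStructure (primaryGaloisModule W p) := SelmerStructure.ofFinite _ fun v =>
    if v = primePlace p then ⊥ else unramifiedSubgroup (GaloisRep.toLocal v (primaryGaloisModule W p)) 1
  let 𝓢zero : SelmerStructure (primaryGaloisModule W p) := SelmerStructure.ofFinite _ fun v =>
    if v ∈ T then ⊥ else unramifiedSubgroup (GaloisRep.toLocal v (primaryGaloisModule W p)) 1
  obtain ⟨k₀, hk₀⟩ := exists_forall_le_natCard_selmerGroup_relaxed_le_sha_points_rat_canonical p W hodd T hpT hT hI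
    𝓢inf 𝓢zero (by simp [𝓢inf]; rfl) (fun v hv => by simp [𝓢inf, hv]) (fun w => rfl)
    (fun v hv => by simp [𝓢zero, hv]; rfl) (fun v hv => by simp [𝓢zero, hv]) (fun w => rfl) hSC
  refine ⟨k₀, fun k hk => ?_⟩
  -- Kato's structures on `E[p^k]`
  let ℛ : SelmerStructure (W.torsionGaloisModule ((p : ℤ) ^ k)) := SelmerStructure.ofFinite _ fun v =>
    if v = primePlace p then ⊤ else unramifiedSubgroup (GaloisRep.toLocal v (W.torsionGaloisModule ((p : ℤ) ^ k))) 1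
  let 𝓢 : SelmerStructure (W.torsionGaloisModule ((p : ℤ) ^ k)) := SelmerStructure.ofFinite _ fun v =>
    if v = primePlace p then ⊥ else unramifiedSubgroup (GaloisRep.toLocal v (W.torsionGaloisModule ((p : ℤ) ^ k))) 1
  have hℛP : ℛ (Sum.inr (primePlace p)) = ⊤ := by simp [ℛ]; rfl
  have hℛur : ∀ v : HeightOneSpectrum (𝓞 ℚ), v ≠ primePlace p →
      ℛ (Sum.inr v) = unramifiedSubgroup (GaloisRep.toLocal v (W.torsionGaloisModule ((p : ℤ) ^ k))) 1 :=
    fun v hv => by simp [ℛ, hv]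
  have hcount := hk₀ k hk 𝓢 ℛ (by simp [𝓢]; rfl) hℛP (fun v hv => by simp [𝓢, hv]) hℛur
  haveI hfin : Finite ℛ.selmerGroup := finite_selmerGroup_relaxed_intPow W p k T hpT hT ℛ hℛur
  obtain ⟨f, hfval, -, hfcard⟩ := exists_addMonoidHom_integralH1_to_selmerGroup W p k ℛ hℛP hℛur (fun w => rfl)
  -- the kernel of `f` is `A ∩ p^k H¹(ℚ, T_pE)` (part 18)
  have hker : f.ker = AddSubgroup.comap (integralH1 (tateRep W p) p ⊤).toAddSubgroup.subtype
      (LinearMap.range (DistribSMul.toLinearMap ℤ_[p] (H1 (tateRep W p) ⊤) ((p : ℤ_[p]) ^ k))).toAddSubgroup := by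
    ext a
    rw [AddMonoidHom.mem_ker, AddSubgroup.mem_comap, Submodule.mem_toAddSubgroup, LinearMap.mem_range]
    have h1 : f a = 0 ↔ ((f a : ℛ.selmerGroup) : galoisCohomology (W.torsionGaloisModule ((p : ℤ) ^ k)) 1) = 0 := by
      exact ⟨fun h => by rw [h]; rfl, fun h => Subtype.ext h⟩
    rw [h1, hfval a]
    exact (ofTopSubgroup_reduceH1Pk_eq_zero_iff W p k (a : H1 (tateRep W p) ⊤)).trans
      ⟨fun ⟨c', hc'⟩ => ⟨c', hc'⟩, fun ⟨c', hc'⟩ => ⟨c', hc'⟩⟩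
  rw [← hker]
  exact (hfcard hfin).trans hcount

end Kato1416

end Summit.BirchSwinnertonDyer.BirchSwinnertonDyer.Theorems.KatoFiniteLevelCount

end
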